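import Literature.IUT.LogThetaLattice.PacketLogVolumes
import Literature.IUT.LogVolume.DegreeVolumeConversion
import HarnessLib

/-!
# [IUTchIII] Proposition 3.9 (iii) "global log-volume = degree" — BRIDGE to the Dupuy–Hilado packet
# model of `Literature.IUT.LogVolume` (abc-iut cell, layer L6 ↔ Cor 3.12 crew)

S. Mochizuki, *Inter-universal Teichmüller theory III*, kurims manuscript (May 2020), §3, Proposition
3.9 (iii), p. 117 [claim: Mochizuki2012, status: disputed]: "by adding the log-volumes of (i) [all but
finitely many of which are zero!] at the various `v_ℚ ∈ 𝕍_ℚ`, one obtains a global log-volume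
`μ^log_{A,𝕍_ℚ} : 𝕄(𝓘^ℚ(^A𝓕_{𝕍_ℚ})) → ℝ` which is invariant with respect to multiplication by elements of
`(†𝕄⊛_mod)_α` … the global log-volume `μ^log_{A,𝕍_ℚ}(𝔍)` is equal to the degree of the arithmetic line
bundle determined by `𝔍` …, relative to a suitable normalization". The statement file
`PacketLogVolumes.lean` (abc-iut-L6-t4) types this as REAL data `GlobalRegion μlog`,
`globalLogVolume μlog` over an abstract family of local log-volumes `μlog : ∀ v_ℚ, Region v_ℚ → ℝ` and
two `Prop`-valued predicates `Prop39iii_invariance`, `Prop39iii_degree` over abstract actions /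
region assignments / degrees; its companion `PacketLogVolumesProofs.lean` (abc-iut-L6-t5) reduces
them to local hypotheses and records that an UNCONDITIONAL instance "NEEDS the
GlobalRegion ↔ ArakelovDivisors bridge (a DEFINITION)". This file IS that bridge, at the level of the
Dupuy–Hilado reading used by the Cor 3.12 crew (abc-iut-c312-3, `Literature.IUT.LogVolume.PacketModel`,
`DegreeVolumeConversion.lean`: T. Dupuy, A. Hilado, *The statement of Mochizuki's Corollary 3.12*,
Def. 3.5.1 / 3.6.3, §3.9, Thm. 3.10.1 [cite: DupuyHilado2025, Thm. 3.10.1]):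

* `DHRegionAt M p` — the `p`-component of a random measurable set of `𝕃` (Dupuy–Hilado Def. 3.5.1,
  Rmk. 3.5.2), i.e. the datum `Region v_ℚ` of Prop 3.9 (iii) at `v_ℚ = p` in the packet model `M`;
* `dhLocalLogVolume M l⋆ p` — `ln ν̄_{𝕃_p}` (Def. 3.6.3) as a function of the `p`-component ALONE (it is
  c312-3's `PacketModel.lnνLp` restricted to that component: `dhLocalLogVolume_eq`), i.e. the datum
  `μlog v_ℚ` of Prop 3.9 (iii), indexed by `𝕍_ℚ := ` the rational primes (`{p : ℕ // p.Prime}`; the archimedean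
  place is NOT part of the Dupuy–Hilado packet model — see "NOT here");
* `PacketModel.LgpIdele.IsSupportedOn t T` — the lgp-idele `t` (§3.9: the `a = (a_v̲)` with
  `D = div(a)`) has all its valuations `0` at primes outside the finite set `T` ("all but finitely
  many of which are zero");
* `dhGlobalRegion M l⋆ t T …` — the region `O_𝕃(−div(t))` (§3.9, c312-3's `PacketModel.region t`) AS
  AN ELEMENT of t4's `GlobalRegion (dhLocalLogVolume M l⋆)`: its local log-volumes vanish off `T`
  (`lnνLp_region_eq_zero_of_not_mem`), so the printed finiteness condition holds.

PROVED: `globalLogVolume_dhGlobalRegion` — t4's global log-volume (the finitely supported sum over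
`𝕍_ℚ`) of `O_𝕃(−div(t))` IS c312-3's `ln ν̄_𝕃` summed over `T`; hence, by c312-3's Thm. 3.10.1 (iii)
(`lnνL_region_eq_neg_ndegLgp`), `globalLogVolume_dhGlobalRegion_eq_neg_ndegLgp`: it equals
`−deĝ̲_lgp(div_T(t))`, the normalised lgp-degree of the arithmetic divisor of `t` with the printed sign
("`−deĝ̲_{lgp,F₀}(D) = ln ν̄_𝕃(O_𝕃(−D))`"); and `prop39iii_degree_dh` — t4's named predicate
`Prop39iii_degree` HOLDS in the Dupuy–Hilado packet model, for the objects "lgp-ideles supported on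
`T`", the region assignment `t ↦ O_𝕃(−div(t))` and the degree `t ↦ −deĝ̲_lgp(div_T(t))` (the normalised
degree of the arithmetic line bundle `O(−div t)`), with normalisation constant `c = 1`.

Deliberately NOT here (NEEDS, named): the INVARIANCE clause `Prop39iii_invariance` under
multiplication by `(†𝕄⊛_mod)_α = F_mod^×` — it rests on the PRODUCT FORMULA over ALL of `𝕍` including the
archimedean places, while the Dupuy–Hilado packet interface `PacketModel F` carries neither an
archimedean factor nor a multiplicative structure / an embedding of `F^×` on its local scalars `Λ_v`
(c312-3's module docstring: "Deliberately NOT here: … archimedean factors (`p = ∞`)"); the local-to-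
global reduction of that clause is abc-iut-L6-t5's `Prop39iii_invariance_of_productFormula`. Nothing
here asserts a disputed claim or takes a side on [IUTchIII] Cor 3.12: the Dupuy–Hilado reading is
used exactly as typed by abc-iut-c312-3 and every theorem below is bookkeeping of finite sums.
Wave-3 discharge seat abc-iut-L6-d3 (MERGE-MAP §1 row `PacketLogVolumes`, "BRIDGE possible now (t4 or
companion)"); node id IUTchIII:Prop3.9(iii).
-/

noncomputable section

namespace Literature.IUT.LogThetaLattice

open Literature.IUT.LogVolume Finset

universe u

variable {F : Type u} [Field F] [NumberField F]

/-! ### The `p`-component of a random measurable set of `𝕃` and its log-measure `ln ν̄_{𝕃_p}` -/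

/-- **IUTchIII:Prop3.9(iii)** (kurims p.117) datum `Region v_ℚ` at `v_ℚ = p` in the Dupuy–Hilado packet
model `M`: the `p`-component `(B_{v⃗})_{j, v⃗ ∈ V(F)_p^{j+1}}` of a random measurable set of `𝕃`
(Dupuy–Hilado Def. 3.5.1, Rmk. 3.5.2; c312-3's `PacketModel.Region` is `∀ p, DHRegionAt M p`).
[cite: DupuyHilado2025, Def. 3.5.1] -/
abbrev DHRegionAt (M : PacketModel F) (p : ℕ) : Type u :=
  (j : ℕ) → (e : Fin (j + 1) → placesOver F p) → Set (M.X p j e)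

/-- **IUTchIII:Prop3.9(iii)** (kurims p.117) datum `μlog v_ℚ` at `v_ℚ = p`: the log-measure
`ln ν̄_{𝕃_p}(B) = (1/ℓ⋆) Σ_{j=1}^{ℓ⋆} 𝔼(log μ̄_{v⃗}(B_{v⃗}) : v⃗ ∈ V(F)_p^{j+1})` (Dupuy–Hilado Def. 3.6.3) written
as a function of the `p`-component alone. [cite: DupuyHilado2025, Def. 3.6.3] -/
def dhLocalLogVolume (M : PacketModel F) (lstar : ℕ) (p : ℕ) (Bp : DHRegionAt M p) : ℝ :=
  (1 / (lstar : ℝ)) * ∑ i : Fin lstar,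
    ∑ e : Fin ((i : ℕ) + 1 + 1) → placesOver F p, M.logμ (Bp ((i : ℕ) + 1) e) * ∏ k, weight F (e k).1

/-- `dhLocalLogVolume` at the `p`-component of a region `B` of `𝕃` IS c312-3's `ln ν̄_{𝕃_p}(B)`
(`PacketModel.lnνLp`). [cite: DupuyHilado2025, Def. 3.6.3] -/
theorem dhLocalLogVolume_eq (M : PacketModel F) (lstar : ℕ) (p : ℕ) (B : M.Region) :
    dhLocalLogVolume M lstar p (B p) = M.lnνLp lstar p B := rfl

/-- **IUTchIII:Prop3.9(iii)** (kurims p.117) the family `μlog : ∀ v_ℚ ∈ 𝕍_ℚ, Region v_ℚ → ℝ` of the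
statement file in the Dupuy–Hilado packet model, indexed by `𝕍_ℚ :=` the rational primes (the model has
no archimedean factor): `v_ℚ = p ↦ ln ν̄_{𝕃_p}`. [cite: DupuyHilado2025, Def. 3.6.3] -/
def dhPrimeLogVolume (M : PacketModel F) (lstar : ℕ) (P : {p : ℕ // p.Prime})
    (Bp : DHRegionAt M P.1) : ℝ :=
  dhLocalLogVolume M lstar P.1 Bp

/-! ### lgp-ideles supported on a finite set of primes; their regions as global regions -/

/-- **IUTchIII:Prop3.9(iii)** (kurims p.117, "all but finitely many of which are zero") — an lgp-idele
`t = (t_{j,v})` (Dupuy–Hilado §3.9: the `a = (a_v̲) ∈ 𝔸_V̲` with `D = div(a)`, one for each component of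
an lgp-divisor) is *supported on* the finite set of primes `T` if every valuation `ord_v(t_{j,v})`
vanishes at places over primes outside `T` (a dot-notation extension of abc-iut-c312-3's
`PacketModel.LgpIdele`, declared here with its absolute name). [cite: DupuyHilado2025, §3.9] -/
def _root_.Literature.IUT.LogVolume.PacketModel.LgpIdele.IsSupportedOn {M : PacketModel F} {lstar : ℕ}
    (t : M.LgpIdele lstar) (T : Finset ℕ) : Prop :=
  ∀ p ∉ T, ∀ (i : Fin lstar) (v : placesOver F p), M.ordv (t i p v) = 0

/-- Off the support, the region `O_𝕃(−div(t))` has log-measure `ln ν̄_{𝕃_p} = 0` (Dupuy–Hilado Thm.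
3.10.1 (iii) at `p` with all `ord_v(t_{j,v}) = 0`). [cite: DupuyHilado2025, Thm. 3.10.1] -/
theorem lnνLp_region_eq_zero_of_not_mem {M : PacketModel F} {lstar : ℕ} {t : M.LgpIdele lstar}
    {T : Finset ℕ} (ht : t.IsSupportedOn T) (p : ℕ) [Fact p.Prime] (hp : p ∉ T) :
    M.lnνLp lstar p (M.region t) = 0 := by
  rw [M.lnνLp_region t p]
  have h0 : ∀ i : Fin lstar,
      FinDivisor.ndeg F (∑ v : placesOver F p, FinDivisor.of v.1 (M.ordv (t i p v))) = 0 := by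
    intro i
    rw [Finset.sum_eq_zero fun v _ => ?_, map_zero]
    rw [ht p hp i v]
    exact Finsupp.single_zero _
  rw [Finset.sum_eq_zero fun i _ => h0 i, mul_zero]

variable (M : PacketModel F) (lstar : ℕ)

/-- **IUTchIII:Prop3.9(iii)** (kurims p.117) — the region `O_𝕃(−div(t))` of an lgp-idele `t` supported
on a finite set of primes `T` (Dupuy–Hilado §3.9; c312-3's `PacketModel.region t`), as an element of
the statement file's `GlobalRegion (dhLocalLogVolume M ℓ⋆)`: "the subset of elements whose components,
indexed by `v_ℚ ∈ 𝕍_ℚ`, have zero log-volume for all but finitely many `v_ℚ`" — here the log-volume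
vanishes at every prime outside `T`. [cite: DupuyHilado2025, §3.9] -/
def dhGlobalRegion (t : M.LgpIdele lstar) (T : Finset ℕ) (ht : t.IsSupportedOn T) :
    GlobalRegion (dhPrimeLogVolume M lstar) :=
  ⟨fun P => M.region t P.1, by
    refine (T.subtype Nat.Prime).finite_toSet.subset fun P hP => ?_
    rw [Finset.mem_coe, Finset.mem_subtype]
    by_contra hPT
    apply hP
    haveI : Fact P.1.Prime := ⟨P.2⟩
    change dhLocalLogVolume M lstar P.1 (M.region t P.1) = 0
    rw [dhLocalLogVolume_eq]
    exact lnνLp_region_eq_zero_of_not_mem ht P.1 hPT⟩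

/-- The components of `dhGlobalRegion` are those of c312-3's `region t`. [cite: DupuyHilado2025, §3.9] -/
@[simp] theorem dhGlobalRegion_val (t : M.LgpIdele lstar) (T : Finset ℕ) (ht : t.IsSupportedOn T)
    (P : {p : ℕ // p.Prime}) : (dhGlobalRegion M lstar t T ht).1 P = M.region t P.1 := rfl

/-! ### The global log-volume of `O_𝕃(−div(t))` is `ln ν̄_𝕃`, hence minus the normalised lgp-degree -/

/-- **IUTchIII:Prop3.9(iii)** (kurims p.117, "by adding the log-volumes … at the various `v_ℚ ∈ 𝕍_ℚ`")
in the Dupuy–Hilado packet model: the statement file's `globalLogVolume` of `O_𝕃(−div(t))`, for `t`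
supported on a finite set `T` of primes, is c312-3's `ln ν̄_𝕃(O_𝕃(−div(t)))` summed over `T`
(Dupuy–Hilado Def. 3.6.3 `ln ν̄_𝕃 = Σ_p ln ν̄_{𝕃_p}`). [cite: DupuyHilado2025, Def. 3.6.3] -/
theorem globalLogVolume_dhGlobalRegion (t : M.LgpIdele lstar) (T : Finset ℕ)
    (hT : ∀ p ∈ T, p.Prime) (ht : t.IsSupportedOn T) :
    globalLogVolume (dhPrimeLogVolume M lstar) (dhGlobalRegion M lstar t T ht) =
      M.lnνL lstar T (M.region t) := by
  unfold globalLogVolume PacketModel.lnνL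
  -- the finitely supported sum over all primes is the sum over the primes of `T`
  rw [finsum_eq_sum_of_support_subset _ (s := T.subtype Nat.Prime) ?_]
  · simp only [dhGlobalRegion_val, dhPrimeLogVolume, dhLocalLogVolume_eq]
    exact Finset.sum_subtype_of_mem (fun p => M.lnνLp lstar p (M.region t)) hT
  · intro P hP
    rw [Finset.mem_coe, Finset.mem_subtype]
    by_contra hPT
    apply hP
    haveI : Fact P.1.Prime := ⟨P.2⟩
    change dhLocalLogVolume M lstar P.1 (M.region t P.1) = 0
    rw [dhLocalLogVolume_eq]
    exact lnνLp_region_eq_zero_of_not_mem ht P.1 hPT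

/-- **IUTchIII:Prop3.9(iii)** (kurims p.117, "the global log-volume `μ^log_{A,𝕍_ℚ}(𝔍)` is equal to the degree
of the arithmetic line bundle determined by `𝔍`") in the Dupuy–Hilado packet model: for `𝔍 = O_𝕃(−div(t))`,
the global log-volume equals `−deĝ̲_lgp(div_T(t))` (Dupuy–Hilado Thm. 3.10.1 (iii) "`−deĝ̲_{lgp,F₀}(D) =
ln ν̄_𝕃(O_𝕃(−D))`", c312-3's `lnνL_region_eq_neg_ndegLgp`). [cite: DupuyHilado2025, Thm. 3.10.1] -/
theorem globalLogVolume_dhGlobalRegion_eq_neg_ndegLgp (t : M.LgpIdele lstar) (T : Finset ℕ)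
    (hT : ∀ p ∈ T, p.Prime) (ht : t.IsSupportedOn T) :
    globalLogVolume (dhPrimeLogVolume M lstar) (dhGlobalRegion M lstar t T ht) =
      -LgpDivisor.ndegLgp (PacketModel.LgpIdele.div M t T) := by
  rw [globalLogVolume_dhGlobalRegion M lstar t T hT ht, M.lnνL_region_eq_neg_ndegLgp t T hT]

/-- **IUTchIII:Prop3.9(iii)** (kurims p.117), the DEGREE CLAUSE as typed by the statement file
(`Prop39iii_degree`: "`∃ c > 0, ∀ 𝔍, μ^log(region 𝔍) = c · deg 𝔍`") HOLDS in the Dupuy–Hilado packet model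
`M`, for the objects `𝔍 =` lgp-ideles supported on a finite set `T` of primes, the region assignment
`𝔍 ↦ O_𝕃(−div(𝔍))` and the degree `𝔍 ↦ −deĝ̲_lgp(div_T(𝔍))` (the normalised degree of the arithmetic line
bundle `O(−div 𝔍)`, sign as printed in Dupuy–Hilado Thm. 3.10.1), with normalisation constant `c = 1`.
The invariance clause `Prop39iii_invariance` is NOT provided here (needs the archimedean factor and
the product formula; see the module docstring). [cite: DupuyHilado2025, Thm. 3.10.1] -/
theorem prop39iii_degree_dh (T : Finset ℕ) (hT : ∀ p ∈ T, p.Prime) :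
    Prop39iii_degree (dhPrimeLogVolume M lstar)
      (fun t : {t : M.LgpIdele lstar // t.IsSupportedOn T} => dhGlobalRegion M lstar t.1 T t.2)
      (fun t => -LgpDivisor.ndegLgp (PacketModel.LgpIdele.div M t.1 T)) :=
  ⟨1, one_pos, fun t => by
    rw [one_mul, globalLogVolume_dhGlobalRegion_eq_neg_ndegLgp M lstar t.1 T hT t.2]⟩

/-- **IUTchIII:Prop3.9(iii)** (kurims p.117) consequence in the Dupuy–Hilado packet model: for an
lgp-idele `t` with all valuations `ord_v(t_{j,v}) ≥ 0` ("effective divisor", the region `O_𝕃(−div t)`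
being contained in `O_𝕃`), the global log-volume is `≤ 0 = μ^log(O_𝕃)` — the sign used downstream
(Cor 3.12 compares such volumes with `0`). [cite: DupuyHilado2025, Thm. 3.10.1] -/
theorem globalLogVolume_dhGlobalRegion_nonpos (t : M.LgpIdele lstar) (T : Finset ℕ)
    (hT : ∀ p ∈ T, p.Prime) (ht : t.IsSupportedOn T)
    (hpos : ∀ (i : Fin lstar) (p : ℕ) (v : placesOver F p), 0 ≤ M.ordv (t i p v)) :
    globalLogVolume (dhPrimeLogVolume M lstar) (dhGlobalRegion M lstar t T ht) ≤ 0 := by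
  classical
  rw [globalLogVolume_dhGlobalRegion_eq_neg_ndegLgp M lstar t T hT ht, neg_nonpos]
  unfold LgpDivisor.ndegLgp PacketModel.LgpIdele.div
  refine mul_nonneg (by positivity) (Finset.sum_nonneg fun i _ => ?_)
  refine FinDivisor.ndeg_nonneg fun v => ?_
  simp only [Finsupp.coe_finsetSum, Finset.sum_apply]
  refine Finset.sum_nonneg fun p _ => Finset.sum_nonneg fun w _ => ?_
  rw [Finsupp.single_apply]
  split_ifs
  · exact hpos i p w
  · exact le_rfl

end Literature.IUT.LogThetaLattice

end
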